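import Summits.CriticalPhenomena.PercolationContinuityZ3.Theorems.FK.InfiniteVolumeDefs
import Literature.Probability.LatticeModels.RandomClusterComparison
import Literature.Probability.LatticeModels.RandomClusterComparisonRatio
import HarnessLib

/-!
# FK-continuity transplant, FO-10 (domain-Markov toolkit, seat A): the comparison inequalities between
# random-cluster measures with different parameters, for the box laws and the box limits `φ^b_{p,q}` on `ℤ^d`

Cell `fk-continuity` (bschramm), row FO-10a ("comparison lemmas over FO-06: GRC Thm. (3.21) p. 48 in infinite
volume"); support file for the FK-continuity transplant (`--supports stmt-CriticalPhenomena-4575`); builds on p205010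
(kernel theorem, internal audit signed; external expert review pending).  Pure proofs over the cell's
`InfiniteVolumeDefs.lean` (FO-06b: `rcBoxLaw`, `IsBoxLimit`, `rcLimit`) and the tree's finite-graph comparison
theorems `rcMeasure_real_mono_of_isUpperSet` (Grimmett 2006, (3.22)) and `rcMeasure_real_mono_of_ratio_le` ((3.23));
no definitions, no named facts, no sorries.  FO-01b (`BernoulliComparison.lean`) has the same inequalities at the
level of the percolation probabilities `θ^b(p,q)`; here they are stated for the MEASURES, on every increasing
(resp. decreasing) local event, which is what the domain-Markov toolkit and FO-11's continuation argument consume.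

## Contents (Grimmett 2006, Thm. (3.21) p. 48 box by box, then Prop. (4.28)(a) p. 78 in the limit `Λ_n ↑ ℤ^d`)

* `isUpperSet_preimage_liftEdges` / `isLowerSet_preimage_liftEdges` — pulling back along the monotone lift.
* `rcBoxLaw_real_mono_of_isUpperSet` — `φ^b_{Λ_n,p₁,q₁}(A) ≤ φ^b_{Λ_n,p₂,q₂}(A)` for `A` increasing measurable,
  `p₁ ≤ p₂`, `q₁ ≥ q₂`, `q₁ ≥ 1`, `q₂ > 0` ((3.22)); `rcBoxLaw_real_mono_of_ratio_le` — the reverse inequality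
  `φ^b_{Λ_n,p₂,q₂}(A) ≤ φ^b_{Λ_n,p₁,q₁}(A)` when `p₂/(q₂(1-p₂)) ≤ p₁/(q₁(1-p₁))` (cross-multiplied, (3.23)).
* `IsBoxLimit.real_le_of_isUpperSet` … the same for two box limits with the same boundary condition `b`
  (Prop. (4.28)(a)): `IsBoxLimit.real_mono_of_le_of_le`, `IsBoxLimit.real_mono_of_ratio_le`, the one-parameter
  corollaries `IsBoxLimit.real_mono_left` (in `p`), `IsBoxLimit.real_anti_right` (in `q`), and the decreasing-event
  forms; `rcLimit_real_mono_left` / `rcLimit_real_anti_right` for THE limits when they exist.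

## References

* G. Grimmett, *The Random-Cluster Model*, Springer 2006: Thm. (3.21) eqs. (3.22)–(3.23) p. 48; Prop. (4.28)(a)
  p. 78 (proof p. 79: "a consequence of Theorems 3.21 and 4.10(a)"). [Grimmett2006]
-/

noncomputable section

open MeasureTheory Set Filter
open scoped Topology ENNReal

namespace Summit.CriticalPhenomena.PercolationContinuityZ3.Theorems.FK

open Literature.Probability.Percolation Literature.Probability.LatticeModels

variable {d : ℕ}

/-! ### Box laws (Grimmett 2006, Thm. (3.21)) -/

section BoxLaw

/-- The pull-back of an increasing event along the (monotone) lift is increasing. [folklore] -/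
theorem isUpperSet_preimage_liftEdges (Λ : Finset (Site d)) {A : Set (BondConfig (Site d))} (hA : IsUpperSet A) :
    IsUpperSet (liftEdges Λ ⁻¹' A) := fun ω ω' hle hω =>
  hA (show liftEdges Λ ω ≤ liftEdges Λ ω' from Set.image_mono hle) hω

/-- The pull-back of a decreasing event along the lift is decreasing. [folklore] -/
theorem isLowerSet_preimage_liftEdges (Λ : Finset (Site d)) {A : Set (BondConfig (Site d))} (hA : IsLowerSet A) :
    IsLowerSet (liftEdges Λ ⁻¹' A) := fun ω ω' hle hω =>
  hA (show liftEdges Λ ω' ≤ liftEdges Λ ω from Set.image_mono hle) hω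

/-- **Comparison inequality (3.22) for the box laws**: for an increasing measurable event `A` of `ℤ^d`,
`0 ≤ p₁ ≤ p₂ ≤ 1`, `0 < q₂ ≤ q₁`, `1 ≤ q₁`: `φ^b_{Λ_n,p₁,q₁}(A) ≤ φ^b_{Λ_n,p₂,q₂}(A)` (both boundary conditions).
[cite: Grimmett2006, Thm. (3.21) eq. (3.22)] -/
theorem rcBoxLaw_real_mono_of_isUpperSet (b : Bool) {p₁ p₂ q₁ q₂ : ℝ} (hp₁ : p₁ ∈ Set.Icc (0 : ℝ) 1)
    (hp₂ : p₂ ∈ Set.Icc (0 : ℝ) 1) (hp : p₁ ≤ p₂) (hq₂ : 0 < q₂) (hq : q₂ ≤ q₁) (hq₁ : 1 ≤ q₁) (n : ℕ)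
    {A : Set (BondConfig (Site d))} (hA : IsUpperSet A) (hAm : MeasurableSet A) :
    (rcBoxLaw d b p₁ q₁ n).real A ≤ (rcBoxLaw d b p₂ q₂ n).real A := by
  rw [rcBoxLaw, rcBoxLaw, map_measureReal_apply (measurable_of_finite _) hAm,
    map_measureReal_apply (measurable_of_finite _) hAm]
  exact rcMeasure_real_mono_of_isUpperSet _ hp₁ hp₂ hp hq₂ hq hq₁ _ (isUpperSet_preimage_liftEdges _ hA)

/-- **Comparison inequality (3.23) for the box laws**: for an increasing measurable event `A`, `0 < q₂ ≤ q₁`,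
`1 ≤ q₁` and `p₂/(q₂(1-p₂)) ≤ p₁/(q₁(1-p₁))` (cross-multiplied): `φ^b_{Λ_n,p₂,q₂}(A) ≤ φ^b_{Λ_n,p₁,q₁}(A)`.
[cite: Grimmett2006, Thm. (3.21) eq. (3.23)] -/
theorem rcBoxLaw_real_mono_of_ratio_le (b : Bool) {p₁ p₂ q₁ q₂ : ℝ} (hp₁ : p₁ ∈ Set.Icc (0 : ℝ) 1)
    (hp₂ : p₂ ∈ Set.Icc (0 : ℝ) 1) (hq₂ : 0 < q₂) (hq : q₂ ≤ q₁) (hq₁ : 1 ≤ q₁)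
    (hpq : p₂ * (q₁ * (1 - p₁)) ≤ p₁ * (q₂ * (1 - p₂))) (n : ℕ)
    {A : Set (BondConfig (Site d))} (hA : IsUpperSet A) (hAm : MeasurableSet A) :
    (rcBoxLaw d b p₂ q₂ n).real A ≤ (rcBoxLaw d b p₁ q₁ n).real A := by
  rw [rcBoxLaw, rcBoxLaw, map_measureReal_apply (measurable_of_finite _) hAm,
    map_measureReal_apply (measurable_of_finite _) hAm]
  exact rcMeasure_real_mono_of_ratio_le _ hp₁ hp₂ hq₂ hq hq₁ hpq _ (isUpperSet_preimage_liftEdges _ hA)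

end BoxLaw

/-! ### Box limits (Grimmett 2006, Prop. (4.28)(a)) -/

namespace IsBoxLimit

variable {b : Bool} {p₁ p₂ q₁ q₂ : ℝ} {P₁ P₂ : Measure (BondConfig (Site d))}

/-- Real-valued convergence of the box laws to a box limit on a local event (from the `ℝ≥0∞` field).
[cite: Grimmett2006, Thm. (4.19)(a)] -/
theorem tendsto_real_of_determinedBy {p q : ℝ} {P : Measure (BondConfig (Site d))} (hP : IsBoxLimit d b p q P)
    {A : Set (BondConfig (Site d))} {K : Finset (Sym2 (Site d))} (hA : DeterminedBy A ↑K) :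
    Tendsto (fun n => (rcBoxLaw d b p q n).real A) atTop (𝓝 (P.real A)) := by
  haveI := hP.isProbabilityMeasure
  simp only [measureReal_def]
  exact (ENNReal.tendsto_toReal (measure_ne_top P A)).comp (hP.tendsto_of_isLocalEvent A ⟨K, hA⟩)

/-- **Comparison inequality (4.28)(a), first line, for the box limits**: if `P₁ = φ^b_{p₁,q₁}` and `P₂ = φ^b_{p₂,q₂}`
are box limits with the same boundary condition, `0 ≤ p₁ ≤ p₂ ≤ 1`, `0 < q₂ ≤ q₁`, `1 ≤ q₁`, then `P₁(A) ≤ P₂(A)` for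
every increasing event `A` determined by finitely many pairs. [cite: Grimmett2006, Prop. (4.28)(a)] -/
theorem real_mono_of_le_of_le (hP₁ : IsBoxLimit d b p₁ q₁ P₁) (hP₂ : IsBoxLimit d b p₂ q₂ P₂)
    (hp₁ : p₁ ∈ Set.Icc (0 : ℝ) 1) (hp₂ : p₂ ∈ Set.Icc (0 : ℝ) 1) (hp : p₁ ≤ p₂) (hq₂ : 0 < q₂) (hq : q₂ ≤ q₁)
    (hq₁ : 1 ≤ q₁) {A : Set (BondConfig (Site d))} {K : Finset (Sym2 (Site d))} (hA : IsUpperSet A)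
    (hAK : DeterminedBy A ↑K) : P₁.real A ≤ P₂.real A :=
  le_of_tendsto_of_tendsto (hP₁.tendsto_real_of_determinedBy hAK) (hP₂.tendsto_real_of_determinedBy hAK)
    (Filter.Eventually.of_forall fun n =>
      rcBoxLaw_real_mono_of_isUpperSet b hp₁ hp₂ hp hq₂ hq hq₁ n hA hAK.measurableSet_of_finset)

/-- **Comparison inequality (4.28)(a), second line, for the box limits**: with `0 < q₂ ≤ q₁`, `1 ≤ q₁` and
`p₂/(q₂(1-p₂)) ≤ p₁/(q₁(1-p₁))` (cross-multiplied), `P₂(A) ≤ P₁(A)` for every increasing local event.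
[cite: Grimmett2006, Prop. (4.28)(a)] -/
theorem real_mono_of_ratio_le (hP₁ : IsBoxLimit d b p₁ q₁ P₁) (hP₂ : IsBoxLimit d b p₂ q₂ P₂)
    (hp₁ : p₁ ∈ Set.Icc (0 : ℝ) 1) (hp₂ : p₂ ∈ Set.Icc (0 : ℝ) 1) (hq₂ : 0 < q₂) (hq : q₂ ≤ q₁) (hq₁ : 1 ≤ q₁)
    (hpq : p₂ * (q₁ * (1 - p₁)) ≤ p₁ * (q₂ * (1 - p₂))) {A : Set (BondConfig (Site d))}
    {K : Finset (Sym2 (Site d))} (hA : IsUpperSet A) (hAK : DeterminedBy A ↑K) : P₂.real A ≤ P₁.real A :=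
  le_of_tendsto_of_tendsto (hP₂.tendsto_real_of_determinedBy hAK) (hP₁.tendsto_real_of_determinedBy hAK)
    (Filter.Eventually.of_forall fun n =>
      rcBoxLaw_real_mono_of_ratio_le b hp₁ hp₂ hq₂ hq hq₁ hpq n hA hAK.measurableSet_of_finset)

/-- **Monotonicity in `p`**: `φ^b_{p₁,q}(A) ≤ φ^b_{p₂,q}(A)` for `p₁ ≤ p₂`, `q ≥ 1`, `A` increasing local.
[cite: Grimmett2006, Prop. (4.28)(a)] -/
theorem real_mono_left {q : ℝ} (hP₁ : IsBoxLimit d b p₁ q P₁) (hP₂ : IsBoxLimit d b p₂ q P₂)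
    (hp₁ : p₁ ∈ Set.Icc (0 : ℝ) 1) (hp₂ : p₂ ∈ Set.Icc (0 : ℝ) 1) (hp : p₁ ≤ p₂) (hq : 1 ≤ q)
    {A : Set (BondConfig (Site d))} {K : Finset (Sym2 (Site d))} (hA : IsUpperSet A) (hAK : DeterminedBy A ↑K) :
    P₁.real A ≤ P₂.real A :=
  hP₁.real_mono_of_le_of_le hP₂ hp₁ hp₂ hp (one_pos.trans_le hq) le_rfl hq hA hAK

/-- **Anti-monotonicity in `q`**: `φ^b_{p,q}(A) ≤ φ^b_{p,q'}(A)` for `1 ≤ q' ≤ q`, `A` increasing local — with `q' = 1`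
and FO-06b's `isBoxLimit_bondPercolation` this compares `φ^b_{p,q}` with Bernoulli percolation `P_p`.
[cite: Grimmett2006, Prop. (4.28)(a)] -/
theorem real_anti_right {p q q' : ℝ} {P P' : Measure (BondConfig (Site d))} (hP : IsBoxLimit d b p q P)
    (hP' : IsBoxLimit d b p q' P') (hp : p ∈ Set.Icc (0 : ℝ) 1) (hq' : 1 ≤ q') (hq : q' ≤ q)
    {A : Set (BondConfig (Site d))} {K : Finset (Sym2 (Site d))} (hA : IsUpperSet A) (hAK : DeterminedBy A ↑K) :
    P.real A ≤ P'.real A :=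
  hP.real_mono_of_le_of_le hP' hp hp le_rfl (one_pos.trans_le hq') hq (hq'.trans hq) hA hAK

/-- **Bernoulli-type lower comparison**: `φ^b_{p',q'}(A) ≤ φ^b_{p,q}(A)` when `1 ≤ q' ≤ q` and
`p' ≤ p/(p + q(1-p))·(…)`, in the cross-multiplied form `p' · q (1-p) ≤ p · q' (1-p')` — with `q' = 1` this is
`P_{p/(p+q(1-p))} ≤ φ^b_{p,q}`, the lower half of the Bernoulli sandwich (Grimmett 2006, (3.23) / (5.6)).
[cite: Grimmett2006, Prop. (4.28)(a)] -/
theorem real_le_of_ratio_le {p p' q q' : ℝ} {P P' : Measure (BondConfig (Site d))} (hP : IsBoxLimit d b p q P)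
    (hP' : IsBoxLimit d b p' q' P') (hp : p ∈ Set.Icc (0 : ℝ) 1) (hp' : p' ∈ Set.Icc (0 : ℝ) 1) (hq' : 1 ≤ q')
    (hq : q' ≤ q) (hpq : p' * (q * (1 - p)) ≤ p * (q' * (1 - p'))) {A : Set (BondConfig (Site d))}
    {K : Finset (Sym2 (Site d))} (hA : IsUpperSet A) (hAK : DeterminedBy A ↑K) : P'.real A ≤ P.real A :=
  hP.real_mono_of_ratio_le hP' hp hp' (one_pos.trans_le hq') hq (hq'.trans hq) hpq hA hAK

/-- Decreasing local events reverse the comparison (4.28)(a): `φ^b_{p₂,q₂}(D) ≤ φ^b_{p₁,q₁}(D)` under the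
hypotheses of `real_mono_of_le_of_le`. [cite: Grimmett2006, Prop. (4.28)(a)] -/
theorem real_anti_of_le_of_le_of_isLowerSet (hP₁ : IsBoxLimit d b p₁ q₁ P₁) (hP₂ : IsBoxLimit d b p₂ q₂ P₂)
    (hp₁ : p₁ ∈ Set.Icc (0 : ℝ) 1) (hp₂ : p₂ ∈ Set.Icc (0 : ℝ) 1) (hp : p₁ ≤ p₂) (hq₂ : 0 < q₂) (hq : q₂ ≤ q₁)
    (hq₁ : 1 ≤ q₁) {D : Set (BondConfig (Site d))} {K : Finset (Sym2 (Site d))} (hD : IsLowerSet D)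
    (hDK : DeterminedBy D ↑K) : P₂.real D ≤ P₁.real D := by
  haveI := hP₁.isProbabilityMeasure
  haveI := hP₂.isProbabilityMeasure
  have hDm : MeasurableSet D := hDK.measurableSet_of_finset
  have hDcK : DeterminedBy Dᶜ ↑K := by
    have h := hDK
    rw [determinedBy_iff] at h ⊢
    exact fun ω ω' hω => not_congr (h ω ω' hω)
  have h := hP₁.real_mono_of_le_of_le hP₂ hp₁ hp₂ hp hq₂ hq hq₁ hD.compl hDcK
  rw [measureReal_compl hDm, measureReal_compl hDm, probReal_univ, probReal_univ] at h
  linarith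

end IsBoxLimit

/-! ### THE limits `rcLimit d b p q`, when they exist (FO-06b: for `p ∈ [0,1]`, `q ≥ 1`) -/

/-- **Monotonicity of `φ^b_{p,q}` in `p`** on increasing local events, for the named limits.
[cite: Grimmett2006, Prop. (4.28)(a)] -/
theorem rcLimit_real_mono_left (b : Bool) {p₁ p₂ q : ℝ}
    (h₁ : ∃ P : Measure (BondConfig (Site d)), IsBoxLimit d b p₁ q P)
    (h₂ : ∃ P : Measure (BondConfig (Site d)), IsBoxLimit d b p₂ q P) (hp₁ : p₁ ∈ Set.Icc (0 : ℝ) 1)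
    (hp₂ : p₂ ∈ Set.Icc (0 : ℝ) 1) (hp : p₁ ≤ p₂) (hq : 1 ≤ q) {A : Set (BondConfig (Site d))}
    {K : Finset (Sym2 (Site d))} (hA : IsUpperSet A) (hAK : DeterminedBy A ↑K) :
    (rcLimit d b p₁ q).real A ≤ (rcLimit d b p₂ q).real A :=
  (isBoxLimit_rcLimit_of_exists h₁).real_mono_left (isBoxLimit_rcLimit_of_exists h₂) hp₁ hp₂ hp hq hA hAK

/-- **Anti-monotonicity of `φ^b_{p,q}` in `q`** on increasing local events, for the named limits.
[cite: Grimmett2006, Prop. (4.28)(a)] -/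
theorem rcLimit_real_anti_right (b : Bool) {p q q' : ℝ}
    (h : ∃ P : Measure (BondConfig (Site d)), IsBoxLimit d b p q P)
    (h' : ∃ P : Measure (BondConfig (Site d)), IsBoxLimit d b p q' P) (hp : p ∈ Set.Icc (0 : ℝ) 1) (hq' : 1 ≤ q')
    (hq : q' ≤ q) {A : Set (BondConfig (Site d))} {K : Finset (Sym2 (Site d))} (hA : IsUpperSet A)
    (hAK : DeterminedBy A ↑K) : (rcLimit d b p q).real A ≤ (rcLimit d b p q').real A :=
  (isBoxLimit_rcLimit_of_exists h).real_anti_right (isBoxLimit_rcLimit_of_exists h') hp hq' hq hA hAK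

end Summit.CriticalPhenomena.PercolationContinuityZ3.Theorems.FK

end
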